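import Summits.CriticalPhenomena.PercolationContinuityZ3.Theorems.PercNearOneGluingNoHeavyLowerTailSahiThreeCopyTwoPointFront
import Summits.CriticalPhenomena.PercolationContinuityZ3.Theorems.PercNearOneGluingNoHeavyLowerTailSahiThreeCopyBernstein
import Literature.Combinatorics.Sahi2008.UniformCube
import Literature.Combinatorics.Sahi2008.FKG

/-!
# `NoHeavyLowerTail` (crux stmt-CriticalPhenomena-4575), Sahi programme: **THE LAW-LEVEL BACK REDUCTION** — integrating the
# back cube out of the three-copy functional: for a free slot `F = f(front)`, the Bernstein average over the BACK profiles of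
# `c_{(π,b)}(F,G,H)` is a functional `Ψ_π(f; Ḡ, H̄, K̄)` of THREE front functions (the back marginals `Ḡ = E_back G`, `H̄ = E_back H`
# and the AND-marginal `K̄ = E_back(GH)`), which satisfy a finite list of LINEAR realizability constraints plus conditional Harris
# `K̄ ≥ Ḡ·H̄`; hence a front-only inequality for `Ψ_π` on that constraint set gives `Σ_b m_b(q)·c_{(π,b)}(F,G,H) ≥ 0` for EVERY back
# cube, EVERY back coin weight and all monotone `G, H : {0,1}^{d+k} → [0,1]`

Support file (Sahi cell, seat `prim-sahi-p1`, generation 64; `--supports stmt-CriticalPhenomena-4575`); companions `…SahiThreeCopyTwoPoint`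
(gen 59: `secF`, `frontFn`, the token form `tc_frontFn_eq`) and `…SahiThreeCopyBernstein` (gen 53: `bern3`, `sum3_coin_eq`).  Pure bookkeeping +
FKG on the back cube; no `sorry`, standard axioms; nothing conjectural is used or asserted.

THE POINT (memo FROM-prim-sahi-p1-gen64-LAW-LEVEL-BACK-REDUCTION).  Sahi's `C₃` / Kahn's conjecture needs `E₃ ≥ 0` at LAW level; the census
conjecture 3C-SAHI (`c_B ≥ 0` for every profile `B` of the whole cube) is stronger than needed.  Keep the FRONT profile `π` (the coordinates the slot
`f` reads) coefficientwise but integrate the BACK: with the back coin weight `w = coinWeight q` on `{0,1}^d` and the front sections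
`G_e = secF k e G`,
`Σ_{b ∈ {0,…,3}^d} m_b(q)·c_{(π,b)}(frontFn f, G, H) = Ψ_π(f; Ḡ, H̄, K̄)`  (`sum_bern3_tc_frontFn`),
`Ψ_π(f;𝒢,ℋ,𝒦) := Σ_{(e₁,e₂,e₃) arr π} [2f(e₁)𝒦(e₁) − f(e₁)𝒦(e₂) − f(e₂)𝒢(e₁)ℋ(e₂) − f(e₂)ℋ(e₁)𝒢(e₂) + f(e₁)𝒢(e₂)ℋ(e₃)]`  (`lawPsi`),
where `Ḡ(e) = E_w G_e`, `H̄(e) = E_w H_e`, `K̄(e) = E_w(G_e H_e)` (`backEx`).  For monotone `G, H` with values in `[0,1]` these front functions satisfy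
(`backEx_*`, `backExMul_*`): `Ḡ, H̄, K̄` and the OR-marginal `L̄ = Ḡ + H̄ − K̄` are monotone with values in `[0,1]`; `K̄ ≤ Ḡ`, `K̄ ≤ H̄`,
`K̄ ≥ Ḡ + H̄ − 1`; and CONDITIONAL HARRIS `Ḡ·H̄ ≤ K̄` (FKG for the back coin weight, level by level).  ★ `sum_bern3_tc_frontFn_nonneg_of_lawPsi`:
if `Ψ_π(f;𝒢,ℋ,𝒦) ≥ 0` for all front triples satisfying these constraints ("CONJECTURE L(f,π)" of the memo — a statement about three functions on
the FRONT cube only), then `Σ_b m_b(q) c_{(π,b)}(frontFn f,G,H) ≥ 0` for every back dimension `d`, every `q ∈ [0,1]^d` and all monotone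
`G,H : {0,1}^{d+k} → [0,1]` — the law-level content of "the slot `f` at front profile `π` is good against everything".  `lawGood_of_frontGood`:
the coefficientwise property `FrontGood` (gen 61) implies the law-level one.  Remark (memo §3): the two-point certificate TP₀ of gen 59 is
EXACTLY the constant-multiplier certificate for Conjecture L that uses only `K̄` monotone + conditional Harris; the OR-marginal, the bounds
`K̄ ≤ min(Ḡ,H̄)` and `[0,1]`-valuedness are the additional (law-level only) resources. [this work]
-/

namespace Summit.CriticalPhenomena.PercolationContinuityZ3.Theorems.SahiThreeCopy

open Finset Function Literature.Combinatorics.Sahi2008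
open scoped BigOperators

noncomputable section

variable {d : ℕ}

/-! ### §1 The law-level functional and the back averages -/

/-- The LAW-LEVEL FUNCTIONAL `Ψ_π(f; 𝒢, ℋ, 𝒦) = Σ_{arr π} [2f(e₁)𝒦(e₁) − f(e₁)𝒦(e₂) − f(e₂)𝒢(e₁)ℋ(e₂) − f(e₂)ℋ(e₁)𝒢(e₂) + f(e₁)𝒢(e₂)ℋ(e₃)]`
of three front functions (marginals `𝒢, ℋ` and AND-marginal `𝒦`). [this work] -/
def lawPsi (k : ℕ) (π : Fin k → ℕ) (f 𝒢 ℋ 𝒦 : Pt k → ℝ) : ℝ :=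
  ∑ e₁ : Pt k, ∑ e₂ : Pt k, ∑ e₃ : Pt k, if IsArr π e₁ e₂ e₃ then
    (2 * f e₁ * 𝒦 e₁ - f e₁ * 𝒦 e₂ - f e₂ * (𝒢 e₁ * ℋ e₂) - f e₂ * (ℋ e₁ * 𝒢 e₂) + f e₁ * (𝒢 e₂ * ℋ e₃)) else 0

/-- The BACK AVERAGE of the front section at level `e`: `Ḡ(e) = E_{coin q} G(e,·)`. [this work] -/
def backEx (k : ℕ) (q : Fin d → ℝ) (G : Pt (d + k) → ℝ) : Pt k → ℝ := fun e => ex (coinWeight q) (secF k e G)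

/-- The back AND-marginal `K̄(e) = E_{coin q}[G(e,·)H(e,·)]`. [this work] -/
def backExMul (k : ℕ) (q : Fin d → ℝ) (G H : Pt (d + k) → ℝ) : Pt k → ℝ := fun e => ex (coinWeight q) (secF k e G * secF k e H)

/-! ### §2 The integration identity -/

/-- Reordering a fourfold sum over two index types (plumbing). [folklore] -/
theorem sum4_comm' {α β : Type*} [Fintype α] [Fintype β] (T : α → α → α → β → ℝ) :
    ∑ x : α, ∑ y : α, ∑ z : α, ∑ b : β, T x y z b = ∑ b : β, ∑ x : α, ∑ y : α, ∑ z : α, T x y z b := by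
  calc (∑ x : α, ∑ y : α, ∑ z : α, ∑ b : β, T x y z b)
      = ∑ x : α, ∑ y : α, ∑ b : β, ∑ z : α, T x y z b := sum_congr rfl fun x _ => sum_congr rfl fun y _ => sum_comm
    _ = ∑ x : α, ∑ b : β, ∑ y : α, ∑ z : α, T x y z b := sum_congr rfl fun x _ => sum_comm
    _ = ∑ b : β, ∑ x : α, ∑ y : α, ∑ z : α, T x y z b := sum_comm

/-- **Three independent back copies integrate to a product of expectations**: `Σ_b m_b(q)·N_b(u;v;r) = E(u)E(v)E(r)` (all real `q`). [this work] -/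
theorem sum_bern3_N3 (q : Fin d → ℝ) (u v r : Pt d → ℝ) :
    ∑ b : Fin d → Fin 4, bern3 q (fun i => ((b i : Fin 4) : ℕ)) * N3 (fun i => ((b i : Fin 4) : ℕ)) u v r =
      ex (coinWeight q) u * ex (coinWeight q) v * ex (coinWeight q) r := by
  rw [ex_mul_ex_mul_ex_coin_eq_sum3, sum3_coin_eq]

/-- `E_{coin q}(1) = 1` (all real `q`). [this work] -/
theorem ex_coinWeight_one (q : Fin d → ℝ) : ex (coinWeight q) (1 : Pt d → ℝ) = 1 := ex_one (sum_coinWeight q)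

/-- ★ **THE LAW-LEVEL BACK REDUCTION IDENTITY.**  For a free slot `F = frontFn k f`, a front profile `π`, arbitrary real `G, H` on
`{0,1}^{d+k}` and ANY real back coin vector `q`:
`Σ_{b ∈ {0,…,3}^d} m_b(q) · c_{(π,b)}(F,G,H) = Ψ_π(f; Ḡ, H̄, K̄)` with `Ḡ = backEx G`, `H̄ = backEx H`, `K̄ = backExMul G H`.
Proof: token form (`tc_frontFn_eq`), exchange of sums, and `Σ_b m_b N_b(u;v;r) = E u·E v·E r`. [this work] -/
theorem sum_bern3_tc_frontFn (k : ℕ) (π : Fin k → ℕ) (q : Fin d → ℝ) (f : Pt k → ℝ) (G H : Pt (d + k) → ℝ) :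
    ∑ b : Fin d → Fin 4, bern3 q (fun i => ((b i : Fin 4) : ℕ)) * tc (appendProf k π (fun i => ((b i : Fin 4) : ℕ))) (frontFn k f) G H =
      lawPsi k π f (backEx k q G) (backEx k q H) (backExMul k q G H) := by
  -- token form, and push the Bernstein weight inside the arrangement sum
  have step1 : ∀ b : Fin d → Fin 4,
      bern3 q (fun i => ((b i : Fin 4) : ℕ)) * tc (appendProf k π (fun i => ((b i : Fin 4) : ℕ))) (frontFn k f) G H =
        ∑ e₁ : Pt k, ∑ e₂ : Pt k, ∑ e₃ : Pt k, if IsArr π e₁ e₂ e₃ then bern3 q (fun i => ((b i : Fin 4) : ℕ)) *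
          (2 * f e₁ * N3 (fun i => ((b i : Fin 4) : ℕ)) (secF k e₁ G * secF k e₁ H) 1 1
            - f e₁ * N3 (fun i => ((b i : Fin 4) : ℕ)) (secF k e₂ G * secF k e₂ H) 1 1
            - f e₂ * N3 (fun i => ((b i : Fin 4) : ℕ)) (secF k e₁ G) (secF k e₂ H) 1
            - f e₂ * N3 (fun i => ((b i : Fin 4) : ℕ)) (secF k e₁ H) (secF k e₂ G) 1
            + f e₁ * N3 (fun i => ((b i : Fin 4) : ℕ)) 1 (secF k e₂ G) (secF k e₃ H)) else 0 := by
    intro b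
    rw [tc_frontFn_eq, mul_sum]
    refine sum_congr rfl fun e₁ _ => ?_
    rw [mul_sum]
    refine sum_congr rfl fun e₂ _ => ?_
    rw [mul_sum]
    refine sum_congr rfl fun e₃ _ => ?_
    split_ifs <;> simp
  simp only [step1]
  rw [← sum4_comm']
  unfold lawPsi
  refine sum_congr rfl fun e₁ _ => sum_congr rfl fun e₂ _ => sum_congr rfl fun e₃ _ => ?_
  by_cases harr : IsArr π e₁ e₂ e₃
  · simp only [harr, if_true]
    have expand : ∀ b : Fin d → Fin 4, bern3 q (fun i => ((b i : Fin 4) : ℕ)) *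
          (2 * f e₁ * N3 (fun i => ((b i : Fin 4) : ℕ)) (secF k e₁ G * secF k e₁ H) 1 1
            - f e₁ * N3 (fun i => ((b i : Fin 4) : ℕ)) (secF k e₂ G * secF k e₂ H) 1 1
            - f e₂ * N3 (fun i => ((b i : Fin 4) : ℕ)) (secF k e₁ G) (secF k e₂ H) 1
            - f e₂ * N3 (fun i => ((b i : Fin 4) : ℕ)) (secF k e₁ H) (secF k e₂ G) 1
            + f e₁ * N3 (fun i => ((b i : Fin 4) : ℕ)) 1 (secF k e₂ G) (secF k e₃ H)) =
        2 * f e₁ * (bern3 q (fun i => ((b i : Fin 4) : ℕ)) * N3 (fun i => ((b i : Fin 4) : ℕ)) (secF k e₁ G * secF k e₁ H) 1 1)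
          - f e₁ * (bern3 q (fun i => ((b i : Fin 4) : ℕ)) * N3 (fun i => ((b i : Fin 4) : ℕ)) (secF k e₂ G * secF k e₂ H) 1 1)
          - f e₂ * (bern3 q (fun i => ((b i : Fin 4) : ℕ)) * N3 (fun i => ((b i : Fin 4) : ℕ)) (secF k e₁ G) (secF k e₂ H) 1)
          - f e₂ * (bern3 q (fun i => ((b i : Fin 4) : ℕ)) * N3 (fun i => ((b i : Fin 4) : ℕ)) (secF k e₁ H) (secF k e₂ G) 1)
          + f e₁ * (bern3 q (fun i => ((b i : Fin 4) : ℕ)) * N3 (fun i => ((b i : Fin 4) : ℕ)) 1 (secF k e₂ G) (secF k e₃ H)) := by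
      intro b; ring
    simp only [expand, sum_add_distrib, sum_sub_distrib, ← mul_sum, sum_bern3_N3, ex_coinWeight_one, mul_one, one_mul]
    unfold backEx backExMul
    ring
  · simp only [harr, if_false, sum_const_zero]

/-! ### §3 Realizability: the constraints satisfied by `(Ḡ, H̄, K̄)` -/

/-- Front sections of a function bounded above are bounded above. [this work] -/
theorem secF_le_of_le : ∀ (k : ℕ) (e : Pt k) {G : Pt (d + k) → ℝ} {c : ℝ}, (∀ w, G w ≤ c) → ∀ y, secF k e G y ≤ c
  | 0, _, _, _, hG, y => hG y
  | k + 1, e, _, _, hG, y => secF_le_of_le k (Fin.tail e) (fun _ => hG _) y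

/-- `E(f) − E(g) = E(f − g)` (plumbing). [this work] -/
theorem ex_sub' {α : Type*} [Fintype α] (μ f g : α → ℝ) : ex μ (f - g) = ex μ f - ex μ g := by
  simp only [ex_def, Pi.sub_apply, mul_sub, sum_sub_distrib]

variable {k : ℕ} {q : Fin d → ℝ} {G H : Pt (d + k) → ℝ}

/-- `Ḡ ≥ 0`. [this work] -/
theorem backEx_nonneg (hq : ∀ i, 0 ≤ q i ∧ q i ≤ 1) (hG : ∀ w, 0 ≤ G w) (e : Pt k) : 0 ≤ backEx k q G e :=
  ex_nonneg (coinWeight_nonneg hq) (secF_nonneg k e hG)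

/-- `Ḡ ≤ 1` when `G ≤ 1`. [this work] -/
theorem backEx_le_one (hq : ∀ i, 0 ≤ q i ∧ q i ≤ 1) (hG1 : ∀ w, G w ≤ 1) (e : Pt k) : backEx k q G e ≤ 1 := by
  unfold backEx
  calc ex (coinWeight q) (secF k e G) ≤ ex (coinWeight q) (1 : Pt d → ℝ) :=
        ex_mono (coinWeight_nonneg hq) fun y => secF_le_of_le k e hG1 y
    _ = 1 := ex_coinWeight_one q

/-- `Ḡ` is monotone in the front level. [this work] -/
theorem backEx_monotone (hq : ∀ i, 0 ≤ q i ∧ q i ≤ 1) (hGm : Monotone G) : Monotone (backEx k q G) :=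
  fun _ _ hee' => ex_mono (coinWeight_nonneg hq) fun y => secF_mono_level k hee' hGm y

/-- `K̄` is monotone in the front level (nonnegative monotone `G, H`). [this work] -/
theorem backExMul_monotone (hq : ∀ i, 0 ≤ q i ∧ q i ≤ 1) (hG : ∀ w, 0 ≤ G w) (hH : ∀ w, 0 ≤ H w) (hGm : Monotone G)
    (hHm : Monotone H) : Monotone (backExMul k q G H) := by
  intro e e' hee'
  unfold backExMul
  rw [← secF_mul, ← secF_mul]
  exact ex_mono (coinWeight_nonneg hq) fun y =>
    secF_mono_level k hee' (hGm.mul hHm hG hH) y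

/-- CONDITIONAL HARRIS: `Ḡ(e)·H̄(e) ≤ K̄(e)` (FKG for the back coin weight, level by level). [this work] -/
theorem backEx_mul_le_backExMul (hq : ∀ i, 0 ≤ q i ∧ q i ≤ 1) (hG : ∀ w, 0 ≤ G w) (hH : ∀ w, 0 ≤ H w) (hGm : Monotone G)
    (hHm : Monotone H) (e : Pt k) : backEx k q G e * backEx k q H e ≤ backExMul k q G H e :=
  ex_mul_ex_le_ex_mul (isFKGMeasure_coinWeight hq) (secF_nonneg k e hG) (secF_nonneg k e hH) (secF_monotone k e hGm)
    (secF_monotone k e hHm)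

/-- `K̄ ≤ Ḡ` when `H ≤ 1`, `G ≥ 0`. [this work] -/
theorem backExMul_le_left (hq : ∀ i, 0 ≤ q i ∧ q i ≤ 1) (hG : ∀ w, 0 ≤ G w) (hH1 : ∀ w, H w ≤ 1) (e : Pt k) :
    backExMul k q G H e ≤ backEx k q G e :=
  ex_mono (coinWeight_nonneg hq) fun y => by
    simpa using mul_le_mul_of_nonneg_left (secF_le_of_le k e hH1 y) (secF_nonneg k e hG y)

/-- `K̄ ≤ H̄` when `G ≤ 1`, `H ≥ 0`. [this work] -/
theorem backExMul_le_right (hq : ∀ i, 0 ≤ q i ∧ q i ≤ 1) (hG1 : ∀ w, G w ≤ 1) (hH : ∀ w, 0 ≤ H w) (e : Pt k) :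
    backExMul k q G H e ≤ backEx k q H e :=
  ex_mono (coinWeight_nonneg hq) fun y => by
    simpa using mul_le_mul_of_nonneg_right (secF_le_of_le k e hG1 y) (secF_nonneg k e hH y)

/-- `K̄ ≥ Ḡ + H̄ − 1` for `[0,1]`-valued `G, H` (`gh ≥ g + h − 1`). [this work] -/
theorem backEx_add_sub_one_le (hq : ∀ i, 0 ≤ q i ∧ q i ≤ 1) (hG1 : ∀ w, G w ≤ 1) (hH1 : ∀ w, H w ≤ 1) (e : Pt k) :
    backEx k q G e + backEx k q H e - 1 ≤ backExMul k q G H e := by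
  unfold backEx backExMul
  have h1 : ex (coinWeight q) (secF k e G) + ex (coinWeight q) (secF k e H) - 1 =
      ex (coinWeight q) (secF k e G + secF k e H - 1) := by
    rw [ex_sub', ex_add, ex_coinWeight_one]
  rw [h1]
  refine ex_mono (coinWeight_nonneg hq) fun y => ?_
  simp only [Pi.sub_apply, Pi.add_apply, Pi.one_apply, Pi.mul_apply]
  nlinarith [secF_le_of_le k e hG1 y, secF_le_of_le k e hH1 y]

/-- The OR-marginal `L̄ = Ḡ + H̄ − K̄` is monotone for monotone `[0,1]`-valued `G, H` (`g + h − gh = 1 − (1−g)(1−h)` is increasing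
on `[0,1]²`). [this work] -/
theorem backOr_monotone (hq : ∀ i, 0 ≤ q i ∧ q i ≤ 1) (hG : ∀ w, 0 ≤ G w) (hG1 : ∀ w, G w ≤ 1) (hH : ∀ w, 0 ≤ H w)
    (hH1 : ∀ w, H w ≤ 1) (hGm : Monotone G) (hHm : Monotone H) :
    Monotone (backEx k q G + backEx k q H - backExMul k q G H) := by
  intro e e' hee'
  simp only [Pi.sub_apply, Pi.add_apply]
  unfold backEx backExMul
  rw [← ex_add, ← ex_sub', ← ex_add, ← ex_sub']
  refine ex_mono (coinWeight_nonneg hq) fun y => ?_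
  simp only [Pi.sub_apply, Pi.add_apply, Pi.mul_apply]
  have a0 := secF_nonneg k e hG y; have a1 := secF_le_of_le k e hG1 y
  have b0 := secF_nonneg k e hH y; have b1 := secF_le_of_le k e hH1 y
  have a'1 := secF_le_of_le k e' hG1 y; have b'1 := secF_le_of_le k e' hH1 y
  have ha := secF_mono_level k hee' hGm y; have hb := secF_mono_level k hee' hHm y
  nlinarith [mul_le_mul (sub_le_sub_left ha 1) (sub_le_sub_left hb 1) (sub_nonneg.2 b'1) (sub_nonneg.2 a1)]

/-! ### §4 The reduction theorem -/

/-- The realizability constraints of the law-level back reduction, for front triples `(𝒢, ℋ, 𝒦)` ("the set R̂" of the memo):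
`𝒢, ℋ ∈ [0,1]` monotone, `𝒦` and the OR-marginal `𝒢 + ℋ − 𝒦` monotone, `𝒢·ℋ ≤ 𝒦 ≤ min(𝒢,ℋ)`, `𝒦 ≥ 𝒢 + ℋ − 1`. [this work] -/
structure LawTriple (k : ℕ) (𝒢 ℋ 𝒦 : Pt k → ℝ) : Prop where
  /-- `𝒢 ≥ 0` -/ g0 : ∀ e, 0 ≤ 𝒢 e
  /-- `𝒢 ≤ 1` -/ g1 : ∀ e, 𝒢 e ≤ 1
  /-- `ℋ ≥ 0` -/ h0 : ∀ e, 0 ≤ ℋ e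
  /-- `ℋ ≤ 1` -/ h1 : ∀ e, ℋ e ≤ 1
  /-- `𝒢` monotone -/ gm : Monotone 𝒢
  /-- `ℋ` monotone -/ hm : Monotone ℋ
  /-- `𝒦` monotone -/ km : Monotone 𝒦
  /-- OR-marginal monotone -/ lm : Monotone (𝒢 + ℋ - 𝒦)
  /-- conditional Harris -/ harris : ∀ e, 𝒢 e * ℋ e ≤ 𝒦 e
  /-- `𝒦 ≤ 𝒢` -/ kg : ∀ e, 𝒦 e ≤ 𝒢 e
  /-- `𝒦 ≤ ℋ` -/ kh : ∀ e, 𝒦 e ≤ ℋ e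
  /-- `𝒦 ≥ 𝒢 + ℋ − 1` -/ kl : ∀ e, 𝒢 e + ℋ e - 1 ≤ 𝒦 e

/-- The back averages of monotone `[0,1]`-valued `G, H` form a `LawTriple`. [this work] -/
theorem lawTriple_backEx (hq : ∀ i, 0 ≤ q i ∧ q i ≤ 1) (hG : ∀ w, 0 ≤ G w) (hG1 : ∀ w, G w ≤ 1) (hH : ∀ w, 0 ≤ H w)
    (hH1 : ∀ w, H w ≤ 1) (hGm : Monotone G) (hHm : Monotone H) :
    LawTriple k (backEx k q G) (backEx k q H) (backExMul k q G H) where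
  g0 := backEx_nonneg hq hG
  g1 := backEx_le_one hq hG1
  h0 := backEx_nonneg hq hH
  h1 := backEx_le_one hq hH1
  gm := backEx_monotone hq hGm
  hm := backEx_monotone hq hHm
  km := backExMul_monotone hq hG hH hGm hHm
  lm := backOr_monotone hq hG hG1 hH hH1 hGm hHm
  harris := backEx_mul_le_backExMul hq hG hH hGm hHm
  kg := backExMul_le_left hq hG hH1
  kh := backExMul_le_right hq hG1 hH
  kl := backEx_add_sub_one_le hq hG1 hH1

/-- "The slot `f` at front profile `π` is good at LAW LEVEL in the back": for every back dimension, every back coin weight in `[0,1]^d` and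
all monotone `[0,1]`-valued `G, H`, the Bernstein average over back profiles of `c_{(π,b)}(frontFn f, G, H)` is nonnegative. [this work] -/
def LawGood (k : ℕ) (π : Fin k → ℕ) (f : Pt k → ℝ) : Prop :=
  ∀ ⦃d : ℕ⦄ (q : Fin d → ℝ), (∀ i, 0 ≤ q i ∧ q i ≤ 1) → ∀ ⦃G H : Pt (d + k) → ℝ⦄, (∀ w, 0 ≤ G w) → (∀ w, G w ≤ 1) →
    (∀ w, 0 ≤ H w) → (∀ w, H w ≤ 1) → Monotone G → Monotone H →
      0 ≤ ∑ b : Fin d → Fin 4, bern3 q (fun i => ((b i : Fin 4) : ℕ)) * tc (appendProf k π (fun i => ((b i : Fin 4) : ℕ))) (frontFn k f) G H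

/-- ★★ **THE LAW-LEVEL BACK REDUCTION THEOREM.**  If the front-only inequality `Ψ_π(f; 𝒢, ℋ, 𝒦) ≥ 0` holds for every `LawTriple (𝒢,ℋ,𝒦)`
on the front cube `{0,1}^k` (Conjecture L(f,π) of the memo), then the slot `f` at front profile `π` is good at law level in the back
(`LawGood`): for every back cube, every back coin weight and all monotone `[0,1]`-valued `G, H`,
`Σ_b m_b(q)·c_{(π,b)}(frontFn f, G, H) ≥ 0`. [this work] -/
theorem lawGood_of_lawPsi {k : ℕ} (π : Fin k → ℕ) (f : Pt k → ℝ)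
    (hΨ : ∀ 𝒢 ℋ 𝒦 : Pt k → ℝ, LawTriple k 𝒢 ℋ 𝒦 → 0 ≤ lawPsi k π f 𝒢 ℋ 𝒦) : LawGood k π f := by
  intro d q hq G H hG hG1 hH hH1 hGm hHm
  rw [sum_bern3_tc_frontFn]
  exact hΨ _ _ _ (lawTriple_backEx hq hG hG1 hH hH1 hGm hHm)

/-- The coefficientwise property `FrontGood` (every back profile separately, gen 61) implies the law-level one. [this work] -/
theorem lawGood_of_frontGood {k : ℕ} {π : Fin k → ℕ} {f : Pt k → ℝ} (h : FrontGood k π f) : LawGood k π f := by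
  intro d q hq G H hG _ hH _ hGm hHm
  exact sum_nonneg fun b _ => mul_nonneg (bern3_nonneg hq _) (h _ hG hH hGm hHm)

/-! ### §5 The pointwise two-point property `(L*)` (gen 64, second landing)

Memo FROM-prim-sahi-p1-gen64 §3: Conjecture L(f,π) is EQUIVALENT to the following statement, in which all the law-level constraints except
monotonicity of the AND-marginal and conditional Harris have disappeared (they only bite on a non-generic set, and `Ψ_π` is homogeneous under
`(𝒢,ℋ,𝒦) ↦ (ε𝒢, εℋ, ε²𝒦)`): for all nonnegative monotone `φ, ψ` and every monotone `κ ≥ φψ` on the front cube, `Ψ_π(f; φ, ψ, κ) ≥ 0`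
("POINTWISE TP₀": for each pair `(φ,ψ)` separately there is a two-point-type plan; gen 59's TP₀ is one plan for all pairs).  Here we record the
easy implications TP₀-hypotheses ⇒ (L*) ⇒ `LawGood`. -/

/-- The POINTWISE TWO-POINT PROPERTY `(L*)` of `(f, π)`: `Ψ_π(f; φ, ψ, κ) ≥ 0` for all nonnegative monotone `φ, ψ` and every monotone `κ`
with `φψ ≤ κ` pointwise.  [this work] -/
def PointwiseTP (k : ℕ) (π : Fin k → ℕ) (f : Pt k → ℝ) : Prop :=
  ∀ φ ψ κ : Pt k → ℝ, (∀ e, 0 ≤ φ e) → (∀ e, 0 ≤ ψ e) → Monotone φ → Monotone ψ → Monotone κ → (∀ e, φ e * ψ e ≤ κ e) →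
    0 ≤ lawPsi k π f φ ψ κ

/-- ★ `(L*)` ⇒ Conjecture L ⇒ `LawGood`: the pointwise two-point property gives law-level goodness against every back cube. [this work] -/
theorem lawGood_of_pointwiseTP {k : ℕ} {π : Fin k → ℕ} {f : Pt k → ℝ} (h : PointwiseTP k π f) : LawGood k π f :=
  lawGood_of_lawPsi π f fun 𝒢 ℋ 𝒦 hT => h 𝒢 ℋ 𝒦 hT.g0 hT.h0 hT.gm hT.hm hT.km hT.harris

/-- `Ψ_π` as a sum over triples weighted by the arrangement indicator. [this work] -/
theorem lawPsi_eq_sum_triple (k : ℕ) (π : Fin k → ℕ) (f 𝒢 ℋ 𝒦 : Pt k → ℝ) :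
    lawPsi k π f 𝒢 ℋ 𝒦 = ∑ σ : Pt k × Pt k × Pt k, arrInd π σ.1 σ.2.1 σ.2.2 *
      (2 * f σ.1 * 𝒦 σ.1 - f σ.1 * 𝒦 σ.2.1 - f σ.2.1 * (𝒢 σ.1 * ℋ σ.2.1) - f σ.2.1 * (ℋ σ.1 * 𝒢 σ.2.1) + f σ.1 * (𝒢 σ.2.1 * ℋ σ.2.2)) := by
  unfold lawPsi
  exact sum3_ite_eq_sum_triple π _

/-- ★ **gen 59's two-point hypotheses imply `(L*)`**: if `θ ≥ 0` satisfies (N1) and (N2) of `tc_frontFn_nonneg_of_twoPoint` for all nonnegative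
monotone level-functions, then `(f,π)` has the pointwise two-point property — apply (N1) to `(κ, 1)`, (N2) to `(φ, ψ)`, and add
`Σ θ·(κ − φψ) ≥ 0`.  So TP₀ ⇒ (L*) ⇒ LawGood, and (memo §3) TP₀ is exactly the `(φ,ψ)`-INDEPENDENT version of (L*). [this work] -/
theorem pointwiseTP_of_twoPoint (k : ℕ) (π : Fin k → ℕ) (f : Pt k → ℝ) (θ : Pt k → Pt k → Pt k → ℝ)
    (hθ : ∀ e₁ e₂ e₃, 0 ≤ θ e₁ e₂ e₃)
    (hN1 : ∀ φ ψ : Pt k → ℝ, (∀ e, 0 ≤ φ e) → (∀ e, 0 ≤ ψ e) → Monotone φ → Monotone ψ →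
      0 ≤ ∑ σ : Pt k × Pt k × Pt k, arrInd π σ.1 σ.2.1 σ.2.2 *
        ((2 * f σ.1 - θ σ.1 σ.2.1 σ.2.2) * (φ σ.1 * ψ σ.1) - f σ.1 * (φ σ.2.1 * ψ σ.2.1)))
    (hN2 : ∀ φ ψ : Pt k → ℝ, (∀ e, 0 ≤ φ e) → (∀ e, 0 ≤ ψ e) → Monotone φ → Monotone ψ →
      0 ≤ ∑ σ : Pt k × Pt k × Pt k, arrInd π σ.1 σ.2.1 σ.2.2 *
        (θ σ.1 σ.2.1 σ.2.2 * (φ σ.1 * ψ σ.1) + f σ.1 * (φ σ.2.1 * ψ σ.2.2)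
          - f σ.2.1 * (φ σ.1 * ψ σ.2.1) - f σ.2.1 * (φ σ.2.1 * ψ σ.1))) :
    PointwiseTP k π f := by
  intro φ ψ κ hφ hψ hφm hψm hκm hκ
  have hκ0 : ∀ e, 0 ≤ κ e := fun e => (mul_nonneg (hφ e) (hψ e)).trans (hκ e)
  have one0 : ∀ e : Pt k, 0 ≤ (1 : Pt k → ℝ) e := fun _ => zero_le_one
  have onem : Monotone (1 : Pt k → ℝ) := fun _ _ _ => le_rfl
  have e1 := hN1 κ 1 hκ0 one0 hκm onem
  have e2 := hN2 φ ψ hφ hψ hφm hψm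
  have e3 : 0 ≤ ∑ σ : Pt k × Pt k × Pt k, arrInd π σ.1 σ.2.1 σ.2.2 * (θ σ.1 σ.2.1 σ.2.2 * (κ σ.1 - φ σ.1 * ψ σ.1)) :=
    sum_nonneg fun σ _ => mul_nonneg (arrInd_nonneg π _ _ _) (mul_nonneg (hθ _ _ _) (sub_nonneg.2 (hκ _)))
  rw [lawPsi_eq_sum_triple]
  have key : ∑ σ : Pt k × Pt k × Pt k, arrInd π σ.1 σ.2.1 σ.2.2 *
      (2 * f σ.1 * κ σ.1 - f σ.1 * κ σ.2.1 - f σ.2.1 * (φ σ.1 * ψ σ.2.1) - f σ.2.1 * (ψ σ.1 * φ σ.2.1) + f σ.1 * (φ σ.2.1 * ψ σ.2.2)) =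
      (∑ σ : Pt k × Pt k × Pt k, arrInd π σ.1 σ.2.1 σ.2.2 *
        ((2 * f σ.1 - θ σ.1 σ.2.1 σ.2.2) * (κ σ.1 * (1 : Pt k → ℝ) σ.1) - f σ.1 * (κ σ.2.1 * (1 : Pt k → ℝ) σ.2.1))) +
      (∑ σ : Pt k × Pt k × Pt k, arrInd π σ.1 σ.2.1 σ.2.2 *
        (θ σ.1 σ.2.1 σ.2.2 * (φ σ.1 * ψ σ.1) + f σ.1 * (φ σ.2.1 * ψ σ.2.2)
          - f σ.2.1 * (φ σ.1 * ψ σ.2.1) - f σ.2.1 * (φ σ.2.1 * ψ σ.1))) +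
      ∑ σ : Pt k × Pt k × Pt k, arrInd π σ.1 σ.2.1 σ.2.2 * (θ σ.1 σ.2.1 σ.2.2 * (κ σ.1 - φ σ.1 * ψ σ.1)) := by
    rw [← sum_add_distrib, ← sum_add_distrib]
    refine sum_congr rfl fun σ _ => ?_
    simp only [Pi.one_apply]
    ring
  rw [key]
  exact add_nonneg (add_nonneg e1 e2) e3

end

end Summit.CriticalPhenomena.PercolationContinuityZ3.Theorems.SahiThreeCopy
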